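import Literature.Computability.Cryptography.AuthenticationPathExtraction
import HarnessLib

/-!
# Authentication paths, II: the honest path is valid (correctness of the tree verifier, Goldreich 2004, Construction 6.4.14)

Topic `Literature/Computability/Cryptography`; companion of `AuthenticationPathExtraction.lean` (the
parsed-data form of the tree verifier `V'` of Goldreich's Constructions 6.4.14 / 6.4.16: `AuthPath.chainKey`,
`AuthPath.PathValid`, `AuthPath.Authentic`, and the forgery-extraction dichotomy of Prop. 6.4.15, Step 4). That
file reads a one-time forgery off a valid signature to a NEW document; this one records the converse,
elementary half needed for the CORRECTNESS of the tree scheme (`SignatureScheme.IsCorrect` of the scheme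
built from these parts): the path the honest signer produces —

* `AuthPath.honestPath pk auth σ` — at level `i` the signer's keys of the two children of `σ ↾ i` and the node's
  one-time signature `auth (σ ↾ i)` of their pair code (Construction 6.4.14, `auth_{σ₁⋯σ_{i-1}}`, PDF p. 237 of
  the held copy; Construction 6.4.16, steps 2–4, p. 249) —

is authentic at every level (`authentic_honestPath`), the verifier's chain of keys along it is the signer's
(`chainKey_honestPath`), and it is VALID as soon as each node's one-time signature verifies under the node's key
and the leaf's signature of the document verifies under the leaf's key (`pathValid_honestPath`; the remaining
input, that honestly produced one-time signatures verify, is the correctness of the one-time scheme).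

On the abstraction `pk : label ↦ key` (review note on the companion): `pk` assigns a key to EVERY node,
visited by the signer or not — as in the memoryless Construction 6.4.16, where the key pair of every node is
determined by the pseudorandom (or, in the ideal scheme of the proof of Prop. 6.4.17, truly random) function;
a node never visited during an attack has signed nothing (`signedAt = ∅` in
`AuthPath.PathValid.exists_oneTime_forgery`), which is Goldreich's treatment of fresh instances in the proof of
Prop. 6.4.15. Everything is proved; no named facts; no machines.

## References

* O. Goldreich, *Foundations of Cryptography II: Basic Applications*, CUP 2004, §6.4.2.2, Construction 6.4.14
  (signing with `S'`, PDF p. 237; `V'` and the parenthetical remarks after its conditions, p. 238); §6.4.2.3,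
  Construction 6.4.16 (p. 249), proof of Prop. 6.4.17 (p. 250).
-/

namespace Literature.Computability.Cryptography

namespace AuthPath

variable {V : List Bool → List Bool → List Bool → Bool} {pairMsg : List Bool → List Bool → List Bool}

/-! ### The honest path (correctness of the tree verifier) -/

section Honest

variable (pk auth : List Bool → List Bool)

/-- `honestPath pk auth σ`: the authentication path the signer produces for the leaf `σ` — at level `i` the
keys of the two children of `σ ↾ i` and the node's one-time signature `auth (σ ↾ i)` of their pair code.
[Goldreich 2004, Construction 6.4.14 (`auth_{σ₁⋯σ_{i-1}} = (v_{σ₁⋯σ_{i-1}0}, v_{σ₁⋯σ_{i-1}1}, S_{s_{σ₁⋯σ_{i-1}}}(v_{σ₁⋯σ_{i-1}0} v_{σ₁⋯σ_{i-1}1}))`,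
PDF p. 237) and Construction 6.4.16 (steps 2–4, p. 249)] [cite: Goldreich2004, Construction 6.4.14] -/
def honestPath (σ : List Bool) : List (List Bool × List Bool × List Bool) :=
  (List.range σ.length).map fun i => (pk (σ.take i ++ [false]), pk (σ.take i ++ [true]), auth (σ.take i))

/-- The honest path has one level per leaf bit. [Goldreich 2004, Construction 6.4.14] [cite: Goldreich2004, Construction 6.4.14] -/
@[simp] theorem length_honestPath (σ : List Bool) : (honestPath pk auth σ).length = σ.length := by
  simp [honestPath]

/-- Level `i` of the honest path. [Goldreich 2004, Construction 6.4.14] [cite: Goldreich2004, Construction 6.4.14] -/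
theorem getElem_honestPath (σ : List Bool) {i : ℕ} (h : i < (honestPath pk auth σ).length) :
    (honestPath pk auth σ)[i] = (pk (σ.take i ++ [false]), pk (σ.take i ++ [true]), auth (σ.take i)) := by
  simp [honestPath]

/-- Every level of the honest path is authentic. [Goldreich 2004, proof of Prop. 6.4.15, Step 4] [cite: Goldreich2004, Prop. 6.4.15 (proof, Step 4)] -/
theorem authentic_honestPath (σ : List Bool) {i : ℕ} (hi : i < σ.length) : Authentic pk σ (honestPath pk auth σ) i := by
  have h : i < (honestPath pk auth σ).length := by simpa using hi
  exact ⟨h, by rw [getElem_honestPath], by rw [getElem_honestPath]⟩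

/-- Along the honest path the verifier holds the signer's keys: `chainKey (pk []) σ (honestPath σ) i = pk (σ ↾ i)`
for `i ≤ |σ|`. [Goldreich 2004, Construction 6.4.14 ("`v_{i-1,σ_i}` is supposed to equal `v_{σ₁⋯σ_i}`", p. 238)]
[cite: Goldreich2004, Construction 6.4.14] -/
theorem chainKey_honestPath (σ : List Bool) {i : ℕ} (hi : i ≤ σ.length) :
    chainKey (pk []) σ (honestPath pk auth σ) i = pk (σ.take i) :=
  chainKey_eq_pk rfl (length_honestPath pk auth σ) (by simpa using hi)
    fun k hk => authentic_honestPath pk auth σ (hk.trans_le hi)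

/-- **Correctness of the tree verifier on honest signatures.** If every node's one-time signature of its
children's pair code verifies under the node's key, and the leaf's signature of the document verifies under
the leaf's key, then the honest signature `(σ, honestPath σ, β)` is valid under the root key `pk []` — the
combinatorial part of "`V'` accepts the signatures of `S'`" for Constructions 6.4.14/6.4.16 (the rest is the
correctness of the one-time scheme). [Goldreich 2004, Construction 6.4.14 (`V'`, the parenthetical remarks
after conditions 2–4, p. 238)] [cite: Goldreich2004, Construction 6.4.14] -/
theorem pathValid_honestPath {σ α β : List Bool}
    (hauth : ∀ i, i < σ.length →
      V (pk (σ.take i)) (pairMsg (pk (σ.take i ++ [false])) (pk (σ.take i ++ [true]))) (auth (σ.take i)) = true)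
    (hleaf : V (pk σ) α β = true) : PathValid V pairMsg (pk []) α σ (honestPath pk auth σ) β where
  length_eq := length_honestPath pk auth σ
  level i h := by
    have hi : i < σ.length := by simpa using h
    rw [chainKey_honestPath pk auth σ hi.le, getElem_honestPath]
    exact hauth i hi
  leaf := by
    rw [chainKey_honestPath pk auth σ le_rfl, List.take_length]
    exact hleaf

end Honest

end AuthPath

end Literature.Computability.Cryptography
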